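import Summits.QuantumFields.QCD.Theorems.RobustYangMillsHandover.Negative.SchemeAsymptotics

/-!
# Line `gap-upset-recut` for crux `SpectralDefectExtinction.ChiralDescent` (item stmt-QuantumFields-17527) —
# stub W `stub_wallNoGo`: the BEYOND-THE-WALL half, and the reduction of W to its EXACT-WALL restriction

The registered stub W (`stub_wallNoGo`, §2 of `Cruxes/ChiralDescent/Lines/gap_upset_recut.lean`) says: for
`N_f ∈ {2,3}`, a mass-scaling regularisation `reg` whose critical masses are frequently below every `c > −1`
(`lim inf_k m_crit(k) ≤ −1`) carries the body (OS data with `IsQCDAlong`, non-trivial non-Gaussian glue, non-trivial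
flavour-changing pseudoscalars, an OS gap and a lattice gap) above NO offset `μ`.  The wall hypothesis splits in two:

* BEYOND the wall (`lim inf m_crit < −1`, i.e. `∃ d > 0, ∃ᶠ k, m_crit(k) < −1 − d`).  Mass scaling forces the
  increments `a_k m_f / Z_m(k) → 0` (`tendsto_massIncrement_zero`), so every bare trajectory
  `m_f(k) = m_crit(k) + a_k m_f / Z_m(k)` is frequently `< −1` and the branch clause `∀ᶠ k, −1 < m_f(k)` of
  `IsQCDAlong` fails for EVERY tuple, every choice of species renormalisations and every OS datum
  (`eventually_wall_lt_mcrit_of_isQCDAlong`, `not_isQCDAlong_of_frequently_mcrit_lt_wall`).  W holds there outright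
  (`wallNoGo_of_beyondWall`), kernel-checked below.
* AT the wall (`lim inf m_crit = −1` exactly: additionally `∀ d > 0, ∀ᶠ k, −1 − d < m_crit(k)`, hopping parameter
  `→ 1/6` along a subsequence).  Here every fixed tuple passes the branch clause and the content of W is the
  decoupling of supercritical (cutoff-mass) Wilson quarks under the asymptotically free measure — pathwise control of
  the Wilson–Dirac inverse at bare mass `≈ −1` in rough gauge fields.  This half is OPEN, no theorem of the tree
  decides it, and it is NOT claimed here.  What IS recorded: W follows from its exact-wall restriction W′
  (`wallNoGo_of_exactWallNoGo` per regularisation, `stub_wallNoGo_of_exactWall` for the registered statement), and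
  one tuple carrying `IsQCDAlong` already places `reg` at or inside the exact wall
  (`eventually_wall_lt_mcrit_of_isQCDAlong`) — so inside the line's composition the wall case is always the exact wall.

Pure bookkeeping over `QCDOS.lean` and `RobustYangMillsHandover/Negative/SchemeAsymptotics.lean`; standard axioms;
a `--supports stmt-QuantumFields-17527` file (it does not close the stub).
-/

namespace Summit.QuantumFields.QCD.Cruxes.ChiralDescent.GapUpsetRecut

open Filter
open Literature.MathematicalPhysics.QuantumFieldTheory
open Summit.QuantumFields.QCD.Theorems.RobustYangMillsHandover.Negative (tendsto_massIncrement_zero)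

variable {Nf : ℕ}

/-! ## §1 Beyond the wall the branch clause fails -/

/-- **One `IsQCDAlong` tuple keeps the regularisation at or inside the exact wall.**  If `N_f ≤ 16`, `reg` has mass
scaling and ONE tuple `m` (with some species renormalisations `z, shift` and OS data `T`) satisfies
`IsQCDAlong (reg.scheme m z shift) T`, then for every `d > 0` eventually `−1 − d < m_crit(k)`: the branch clause gives
`−1 < m_crit(k) + a_k m_f / Z_m(k)` eventually at the flavour `f = 0`, and the increment is eventually `< d`
(`tendsto_massIncrement_zero`). [folklore] -/
theorem eventually_wall_lt_mcrit_of_isQCDAlong (hNf : 0 < Nf) (hNf16 : Nf ≤ 16) (reg : QCDRegularisation Nf)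
    (hMS : reg.HasMassScaling) {m : Fin Nf → ℝ} {z shift : QCDField Nf → ℕ → ℝ} {T : OSData (QCDField Nf) 4}
    (hQ : IsQCDAlong (reg.scheme m z shift) T) {d : ℝ} (hd : 0 < d) :
    ∀ᶠ k in atTop, -1 - d < reg.mcrit k := by
  obtain ⟨-, hbranch, -⟩ := hQ
  have hev : ∀ᶠ k in atTop, reg.a k * m ⟨0, hNf⟩ / reg.Zm k < d :=
    (tendsto_order.mp (tendsto_massIncrement_zero hNf16 reg hMS (m ⟨0, hNf⟩))).2 d hd
  filter_upwards [hbranch ⟨0, hNf⟩, hev] with k hk hk'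
  rw [QCDRegularisation.scheme_mq] at hk
  linarith

/-- **Beyond the wall no tuple is `IsQCDAlong`.**  If `0 < N_f ≤ 16`, `reg` has mass scaling and its critical masses
are frequently below `−1 − d` for some `d > 0` (`lim inf m_crit < −1`), then for EVERY tuple `m`, all species
renormalisations `z, shift` and all OS data `T`, `IsQCDAlong (reg.scheme m z shift) T` fails: at a `k` with
`m_crit(k) < −1 − d` and `a_k m_0 / Z_m(k) < d` the bare mass of flavour `0` is `< −1`, against the branch clause.
[folklore] -/
theorem not_isQCDAlong_of_frequently_mcrit_lt_wall (hNf : 0 < Nf) (hNf16 : Nf ≤ 16) (reg : QCDRegularisation Nf)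
    (hMS : reg.HasMassScaling) (hbeyond : ∃ d : ℝ, 0 < d ∧ ∃ᶠ k in atTop, reg.mcrit k < -1 - d)
    (m : Fin Nf → ℝ) (z shift : QCDField Nf → ℕ → ℝ) (T : OSData (QCDField Nf) 4) :
    ¬ IsQCDAlong (reg.scheme m z shift) T := by
  intro hQ
  obtain ⟨d, hd, hfreq⟩ := hbeyond
  obtain ⟨k, hk, hk'⟩ :=
    (hfreq.and_eventually (eventually_wall_lt_mcrit_of_isQCDAlong hNf hNf16 reg hMS hQ hd)).exists
  linarith

/-! ## §2 W beyond the wall, and W from its exact-wall restriction -/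

/-- **W BEYOND THE WALL (kernel-checked half of the registered stub `stub_wallNoGo`).**  For `N_f ∈ {2,3}` and a
mass-scaling regularisation with `m_crit(k) < −1 − d` frequently for some `d > 0`, NO offset `μ` has the body at every
tuple above it: already the tuple `(μ + 1, …, μ + 1)` carries no `IsQCDAlong` data
(`not_isQCDAlong_of_frequently_mcrit_lt_wall`). [folklore] -/
theorem wallNoGo_of_beyondWall : ∀ Nf : ℕ, (Nf = 2 ∨ Nf = 3) → ∀ reg : QCDRegularisation Nf, reg.HasMassScaling →
    (∃ d : ℝ, 0 < d ∧ ∃ᶠ k in atTop, reg.mcrit k < -1 - d) → ∀ μ : ℝ,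
    ¬ ∀ m : Fin Nf → ℝ, (∀ f, μ < m f) →
      ∃ (z shift : QCDField Nf → ℕ → ℝ) (T : OSData (QCDField Nf) 4),
        IsQCDAlong (reg.scheme m z shift) T ∧ T.IsNontrivial QCDField.glue ∧ T.IsNonGaussian QCDField.glue ∧
          (∀ f g : Fin Nf, f ≠ g → T.IsNontrivial (QCDField.pseudoRe f g)) ∧
            ∃ Δ > 0, T.HasMassGap Δ ∧ (reg.scheme m z shift).HasLatticeMassGap Δ := by
  intro Nf hNf reg hMS hbeyond μ hbody
  have hNf0 : 0 < Nf := by rcases hNf with rfl | rfl <;> norm_num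
  have hNf16 : Nf ≤ 16 := by rcases hNf with rfl | rfl <;> norm_num
  obtain ⟨z, shift, T, hQ, -⟩ := hbody (fun _ => μ + 1) fun _ => by linarith
  exact not_isQCDAlong_of_frequently_mcrit_lt_wall hNf0 hNf16 reg hMS hbeyond _ z shift T hQ

/-- **The wall dichotomy.**  A regularisation whose critical masses are NOT eventually above `−1 − d` for every `d > 0`
is beyond the wall: `m_crit(k) < −1 − d` frequently for some `d > 0` (pass from `≤ −1 − d` frequently to `< −1 − d/2`).
[folklore] -/
theorem beyondWall_of_not_exactWall (reg : QCDRegularisation Nf)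
    (h : ¬ ∀ d : ℝ, 0 < d → ∀ᶠ k in atTop, -1 - d < reg.mcrit k) :
    ∃ d : ℝ, 0 < d ∧ ∃ᶠ k in atTop, reg.mcrit k < -1 - d := by
  by_contra hcon
  refine h fun d hd => ?_
  by_contra hnev
  refine hcon ⟨d / 2, by linarith, ?_⟩
  exact (Filter.not_eventually.mp hnev).mono fun k hk => by linarith [not_lt.mp hk]

/-- **W for ONE regularisation from its exact-wall case.**  For `N_f ∈ {2,3}` and a mass-scaling `reg`: if the no-go
conclusion of W (no offset carries the body) is known UNDER the extra exact-wall hypothesis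
`∀ d > 0, ∀ᶠ k, −1 − d < m_crit(k)`, then it holds outright — the complementary case is beyond the wall
(`beyondWall_of_not_exactWall`, `wallNoGo_of_beyondWall`).  The frequently-below-every-`c > −1` hypothesis of W is
not even needed for this step. [folklore] -/
theorem wallNoGo_of_exactWallNoGo (hNf : Nf = 2 ∨ Nf = 3) (reg : QCDRegularisation Nf) (hMS : reg.HasMassScaling)
    (hexact : (∀ d : ℝ, 0 < d → ∀ᶠ k in atTop, -1 - d < reg.mcrit k) → ∀ μ : ℝ,
      ¬ ∀ m : Fin Nf → ℝ, (∀ f, μ < m f) →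
        ∃ (z shift : QCDField Nf → ℕ → ℝ) (T : OSData (QCDField Nf) 4),
          IsQCDAlong (reg.scheme m z shift) T ∧ T.IsNontrivial QCDField.glue ∧ T.IsNonGaussian QCDField.glue ∧
            (∀ f g : Fin Nf, f ≠ g → T.IsNontrivial (QCDField.pseudoRe f g)) ∧
              ∃ Δ > 0, T.HasMassGap Δ ∧ (reg.scheme m z shift).HasLatticeMassGap Δ) (μ : ℝ) :
    ¬ ∀ m : Fin Nf → ℝ, (∀ f, μ < m f) →
      ∃ (z shift : QCDField Nf → ℕ → ℝ) (T : OSData (QCDField Nf) 4),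
        IsQCDAlong (reg.scheme m z shift) T ∧ T.IsNontrivial QCDField.glue ∧ T.IsNonGaussian QCDField.glue ∧
          (∀ f g : Fin Nf, f ≠ g → T.IsNontrivial (QCDField.pseudoRe f g)) ∧
            ∃ Δ > 0, T.HasMassGap Δ ∧ (reg.scheme m z shift).HasLatticeMassGap Δ := by
  by_cases hw : ∀ d : ℝ, 0 < d → ∀ᶠ k in atTop, -1 - d < reg.mcrit k
  · exact hexact hw μ
  · exact wallNoGo_of_beyondWall Nf hNf reg hMS (beyondWall_of_not_exactWall reg hw) μ

/-- **The registered stub W follows from its EXACT-WALL restriction W′** (W with the extra hypothesis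
`∀ d > 0, ∀ᶠ k, −1 − d < m_crit(k)`, i.e. `lim inf m_crit = −1` exactly: decoupling of supercritical Wilson quarks at
hopping parameter `→ 1/6`, the open half).  The conclusion is VERBATIM the statement of `stub_wallNoGo` of
`Cruxes/ChiralDescent/Lines/gap_upset_recut.lean`. [folklore] -/
theorem stub_wallNoGo_of_exactWall
    (hW' : ∀ Nf : ℕ, (Nf = 2 ∨ Nf = 3) → ∀ reg : QCDRegularisation Nf, reg.HasMassScaling →
      (∀ c : ℝ, -1 < c → ∃ᶠ k in atTop, reg.mcrit k < c) →
      (∀ d : ℝ, 0 < d → ∀ᶠ k in atTop, -1 - d < reg.mcrit k) → ∀ μ : ℝ,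
      ¬ ∀ m : Fin Nf → ℝ, (∀ f, μ < m f) →
        ∃ (z shift : QCDField Nf → ℕ → ℝ) (T : OSData (QCDField Nf) 4),
          IsQCDAlong (reg.scheme m z shift) T ∧ T.IsNontrivial QCDField.glue ∧ T.IsNonGaussian QCDField.glue ∧
            (∀ f g : Fin Nf, f ≠ g → T.IsNontrivial (QCDField.pseudoRe f g)) ∧
              ∃ Δ > 0, T.HasMassGap Δ ∧ (reg.scheme m z shift).HasLatticeMassGap Δ) :
    ∀ Nf : ℕ, (Nf = 2 ∨ Nf = 3) → ∀ reg : QCDRegularisation Nf, reg.HasMassScaling →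
    (∀ c : ℝ, -1 < c → ∃ᶠ k in atTop, reg.mcrit k < c) → ∀ μ : ℝ,
    ¬ ∀ m : Fin Nf → ℝ, (∀ f, μ < m f) →
      ∃ (z shift : QCDField Nf → ℕ → ℝ) (T : OSData (QCDField Nf) 4),
        IsQCDAlong (reg.scheme m z shift) T ∧ T.IsNontrivial QCDField.glue ∧ T.IsNonGaussian QCDField.glue ∧
          (∀ f g : Fin Nf, f ≠ g → T.IsNontrivial (QCDField.pseudoRe f g)) ∧
            ∃ Δ > 0, T.HasMassGap Δ ∧ (reg.scheme m z shift).HasLatticeMassGap Δ :=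
  fun Nf hNf reg hMS hwall μ => wallNoGo_of_exactWallNoGo hNf reg hMS (fun hex => hW' Nf hNf reg hMS hwall hex) μ

/-! ## §3 What the exact wall looks like from inside the body -/

/-- **Inside the body the wall is always the EXACT wall.**  For `N_f ∈ {2,3}` and a mass-scaling `reg` carrying the
body above some offset `μ`, the critical masses are eventually above `−1 − d` for every `d > 0`; together with the wall
hypothesis of W (`m_crit(k) < c` frequently for every `c > −1`) this is `lim inf_k m_crit(k) = −1` on the nose — the
only regime in which W has content beyond the branch clause. [folklore] -/
theorem exactWall_of_bodyAbove (hNf : Nf = 2 ∨ Nf = 3) (reg : QCDRegularisation Nf) (hMS : reg.HasMassScaling)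
    {μ : ℝ}
    (hbody : ∀ m : Fin Nf → ℝ, (∀ f, μ < m f) →
      ∃ (z shift : QCDField Nf → ℕ → ℝ) (T : OSData (QCDField Nf) 4),
        IsQCDAlong (reg.scheme m z shift) T ∧ T.IsNontrivial QCDField.glue ∧ T.IsNonGaussian QCDField.glue ∧
          (∀ f g : Fin Nf, f ≠ g → T.IsNontrivial (QCDField.pseudoRe f g)) ∧
            ∃ Δ > 0, T.HasMassGap Δ ∧ (reg.scheme m z shift).HasLatticeMassGap Δ) {d : ℝ} (hd : 0 < d) :
    ∀ᶠ k in atTop, -1 - d < reg.mcrit k := by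
  have hNf0 : 0 < Nf := by rcases hNf with rfl | rfl <;> norm_num
  have hNf16 : Nf ≤ 16 := by rcases hNf with rfl | rfl <;> norm_num
  obtain ⟨z, shift, T, hQ, -⟩ := hbody (fun _ => μ + 1) fun _ => by linarith
  exact eventually_wall_lt_mcrit_of_isQCDAlong hNf0 hNf16 reg hMS hQ hd

end Summit.QuantumFields.QCD.Cruxes.ChiralDescent.GapUpsetRecut
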